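import Summits.ResolutionOfSingularities.ResolutionOfSingularities.Theorems.WeightedInvariantELadderOneStageInv
import Summits.ResolutionOfSingularities.ResolutionOfSingularities.Theorems.WeightedInvariantELadderOneMeasure
import Literature.AlgebraicGeometry.Resolution.NonPrincipalLocus
import Literature.AlgebraicGeometry.Resolution.RegularLocalRingsProofs
import HarnessLib

/-!
# Rung `e = 1` of the door: the Abramovich–Quek–Schober hypotheses at a maximal singular point (assembly step A1)

Route `ResolutionOfSingularities/WeightedInvariant`, door crux `HypersurfaceCentreConstruction`
(stmt-ResolutionOfSingularities-19897) — OURS, helper; e-ladder rung `e = 1`, registered stub `stub_e1_centre`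
(skeleton v3.6; `D/res-D-pv-025/DOOR-ELADDER-PLAN.md` v1.3 §8, assembly step **A1** «AQS hypotheses at
`η ∈ maxSing`»; res-type-047, second hand).  The facts `AbramovichQuekSchober2025_heightTwoCentre` /
`…_separableBaseChange` are stated at a point `η` whose local ring is regular of dimension `2` and at which the
hypersurface stalk `X_η` is PRINCIPAL, NON-ZERO and NOT of the form `(y^ν)` for a regular parameter `y`
("`C_red` singular at `q`").  For a stage `S` of the e-ladder (`ELadderOne.Stage`) satisfying `Inv'` and a maximal
singular point `η ∈ S.maxSing` these hold:

* regular of dimension `2` — `Inv'.invReg` (res-type-017, p513926);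
* `X_η` principal — the kernel `ker i` is locally principal (`Stage.isLocallyPrincipal`,
  `IsLocallyPrincipalAt.isPrincipal_stalkIdeal`);
* `X_η ≠ 0` — `Stage.stalkIdeal_ne_bot_of_mem_singImage` (res-D-pv-023);
* `X_η ≠ (y^ν)` for `y ∈ 𝔪_η ∖ 𝔪_η²` and every `ν` — `Stage.stalkIdeal_ker_ne_span_pow`: `ν = 0` contradicts
  `η ∈ supp X`; `ν = 1` contradicts `η ∈ singImage` (`𝒪_{Y,η}/(y)` is regular,
  `mem_singImage_iff_mem_sq_of_stalkIdeal_eq`); `ν ≥ 2` contradicts REDUCEDNESS: `𝒪_{Y,η}/X_η ≅ 𝒪_{X,x}` (closed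
  immersion: `stalkMap` onto with kernel `X_η`, `stalkIdeal_ker_eq_ker_stalkMap`) is reduced since `S.X` is
  integral, while `ȳ ≠ 0` with `ȳ^ν = 0` in `𝒪_{Y,η}/(y^ν)`.

`Stage.aqs_hypotheses_of_mem_maxSing` bundles the five clauses in the order the facts consume them.  No
definitions; nothing here is a claim about Hironaka's problem or any manuscript under adjudication; AI-written,
weaker than expert review.
-/

noncomputable section

set_option linter.dupNamespace false -- mandated namespace of this single-conjunct summit

open CategoryTheory AlgebraicGeometry TopologicalSpace IsLocalRing
open Literature.AlgebraicGeometry.Resolution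
open Summit.ResolutionOfSingularities.ResolutionOfSingularities.Theorems
open Summit.ResolutionOfSingularities.ResolutionOfSingularities.Cruxes.HypersurfaceCentreConstruction.LocalEngine

namespace Summit.ResolutionOfSingularities.ResolutionOfSingularities.Theorems.ELadderOne

namespace Stage

variable {k : Type} [Field k] (S : Stage k)

/-- The stalk of the hypersurface ideal `ker i` of a stage is principal at every point. [folklore] -/
theorem isPrincipal_stalkIdeal_ker (y : S.Y) : (stalkIdeal S.i.ker y).IsPrincipal :=
  (S.isLocallyPrincipal y).isPrincipal_stalkIdeal

/-- **`X_η` is not `(y^ν)` for a regular parameter `y` at a point of the singular image.**  For a stage `S`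
(ambient smooth over a field, hypersurface integral) and `η ∈ singImage (ker i)`: for every `y ∈ 𝔪_η ∖ 𝔪_η²`
and every `ν`, `X_η ≠ (y^ν)` — `ν = 0`: `η` lies in the support; `ν = 1`: the quotient by a regular parameter
is regular, but `η` is a singular point of `V(X)`; `ν ≥ 2`: `𝒪_{Y,η}/X_η ≅ 𝒪_{X,x}` is reduced (`S.X` integral),
but `ȳ` would be a non-zero nilpotent. [folklore] -/
theorem stalkIdeal_ker_ne_span_pow {η : S.Y} (hη : η ∈ singImage S.i.ker)
    (y : S.Y.presheaf.stalk η) (hy : y ∈ maximalIdeal (S.Y.presheaf.stalk η))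
    (hy2 : y ∉ maximalIdeal (S.Y.presheaf.stalk η) ^ 2) (ν : ℕ) :
    stalkIdeal S.i.ker η ≠ Ideal.span {y ^ ν} := by
  haveI : IsLocallyNoetherian S.Y := LocallyOfFiniteType.isLocallyNoetherian S.f
  have hY : Scheme.IsRegular S.Y := Scheme.IsRegular.of_smooth S.f (Scheme.isRegular_Spec (.of k))
  haveI : IsRegularLocalRing (S.Y.presheaf.stalk η) := hY η
  haveI : IsDomain (S.Y.presheaf.stalk η) := isDomain_of_isRegularLocalRing _
  intro hEq
  rcases ν with _ | ν
  · -- `ν = 0`: `X_η = ⊤`, but `η ∈ supp X`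
    rw [pow_zero, Ideal.span_singleton_one] at hEq
    have hle := (mem_support_iff_stalkIdeal_le S.i.ker η).mp (mem_support_of_mem_singImage S.i.ker hη)
    rw [hEq, top_le_iff] at hle
    exact (maximalIdeal.isMaximal (S.Y.presheaf.stalk η)).ne_top hle
  · have hy0 : y ≠ 0 := fun h => hy2 (h ▸ Ideal.zero_mem _)
    have hg0 : y ^ (ν + 1) ≠ 0 := pow_ne_zero _ hy0
    -- `η ∈ singImage` forces `y^(ν+1) ∈ 𝔪²`
    have hsq := (mem_singImage_iff_mem_sq_of_stalkIdeal_eq S.i.ker hEq hg0).mp hη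
    rcases ν with _ | ν
    · -- `ν = 1`
      exact hy2 (by simpa using hsq)
    · -- `ν ≥ 2`: reducedness of `𝒪_{Y,η}/X_η ≅ 𝒪_{X,x}`
      obtain ⟨x', hx', -⟩ := hη
      obtain ⟨x₀, hx₀⟩ := S.i.toImage.surjective x'
      have hix : S.i x₀ = η := by
        rw [← hx', ← hx₀, ← Scheme.Hom.comp_apply, Scheme.Hom.toImage_imageι]
      subst hix
      have hker : RingHom.ker (S.i.stalkMap x₀).hom = Ideal.span {y ^ (ν + 1 + 1)} := by
        rw [← stalkIdeal_ker_eq_ker_stalkMap S.i x₀, hEq]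
      -- `ȳ ≠ 0` and `ȳ^(ν+2) = 0` in the reduced ring `𝒪_{X,x₀}`
      have hzero : (S.i.stalkMap x₀).hom (y ^ (ν + 1 + 1)) = 0 := by
        rw [← RingHom.mem_ker, hker]; exact Ideal.mem_span_singleton_self _
      rw [map_pow] at hzero
      have hy' : (S.i.stalkMap x₀).hom y = 0 := IsReduced.eq_zero _ ⟨_, hzero⟩
      rw [← RingHom.mem_ker, hker, Ideal.mem_span_singleton] at hy'
      obtain ⟨a, ha⟩ := hy'
      -- `y = a y^(ν+2)` in the domain `𝒪_{Y,η}` with `y ∈ 𝔪 ∖ 0`: `1 = a y^(ν+1)`, so `y` is a unit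
      have h1 : y * (1 - y ^ (ν + 1) * a) = 0 := by
        rw [mul_sub, mul_one, ← mul_assoc, ← pow_succ', sub_eq_zero]; exact ha
      rcases mul_eq_zero.mp h1 with h | h
      · exact hy0 h
      · rw [sub_eq_zero] at h
        have hu : IsUnit y := IsUnit.of_mul_eq_one (y ^ ν * a) (by
          rw [← mul_assoc, ← pow_succ']; exact h.symm)
        rw [mem_maximalIdeal, mem_nonunits_iff] at hy
        exact hy hu

/-- **A1 — the Abramovich–Quek–Schober hypotheses at a maximal singular point of a stage satisfying `Inv'`**:
`𝒪_{Y,η}` regular of dimension `2`; `X_η` principal, non-zero, and not `(y^ν)` for any regular parameter `y` and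
any `ν` (the five hypotheses of `AbramovichQuekSchober2025_heightTwoCentre` / `…_separableBaseChange` at `η`, in
their order). [folklore] -/
theorem aqs_hypotheses_of_mem_maxSing (hInv : S.Inv') {η : S.Y} (hη : η ∈ S.maxSing) :
    IsRegularLocalRing (S.Y.presheaf.stalk η) ∧
    ringKrullDim (S.Y.presheaf.stalk η) = ((2 : ℕ) : WithBot ℕ∞) ∧
    (stalkIdeal S.i.ker η).IsPrincipal ∧ stalkIdeal S.i.ker η ≠ ⊥ ∧
    (∀ y : S.Y.presheaf.stalk η, y ∈ maximalIdeal (S.Y.presheaf.stalk η) →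
      y ∉ maximalIdeal (S.Y.presheaf.stalk η) ^ 2 → ∀ ν : ℕ, stalkIdeal S.i.ker η ≠ Ideal.span {y ^ ν}) :=
  ⟨(hInv.invReg η hη).1, (hInv.invReg η hη).2, S.isPrincipal_stalkIdeal_ker η,
    S.stalkIdeal_ne_bot_of_mem_singImage hη.1,
    fun y hy hy2 ν => S.stalkIdeal_ker_ne_span_pow hη.1 y hy hy2 ν⟩

end Stage

end Summit.ResolutionOfSingularities.ResolutionOfSingularities.Theorems.ELadderOne

end
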